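import Summits.RiemannHypothesis.RiemannHypothesis.Theses.LeeYang
import Literature.NumberTheory.LFunctions.DobnerLemma4Proofs
import Literature.NumberTheory.LFunctions.PolyaKernelRHProofs

/-!
# Stub K0 of line `Sketch` (crux `LeeYang.LeeyangNeg`, stmt-RiemannHypothesis-0457):
`ν_Φ` lies on the Lee–Yang boundary

For the de Bruijn law `ν_Φ = Φ du / ∫Φ` and every `c > 0`, the anti-tilted measure `e^{-cu²} dν_Φ`
does not have the Lee–Yang property: its two-sided Laplace transform is `(∫Φ)⁻¹ · 2 H_{-c}(iz)`
and `H_{-c}` has a non-real zero (Newman's conjecture, `rodgers_tao_holds`).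
-/

noncomputable section

set_option linter.dupNamespace false

open MeasureTheory

namespace Summit.RiemannHypothesis.RiemannHypothesis.Theorems.LeeYangProductTowers

open Literature.Probability.LatticeModels Literature.NumberTheory.LFunctions

section Laplace

open Complex Set

/-- The tilted Laplace integrand `e^{zu} e^{-cu²} Φ(u)` is integrable on `(0, ∞)`: it is
continuous and dominated by `e^{-cu²} |Φ(u)| e^{|re z| u}`
(`Literature.NumberTheory.LFunctions.integrableOn_deBruijnHBound` with `T = -c`, `Y = |re z|`). -/
theorem integrableOn_exp_mul_gauss_deBruijnPhi_Ioi (c : ℝ) (z : ℂ) :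
    IntegrableOn
      (fun u : ℝ => cexp (z * u) * (Real.exp (-(c * u ^ 2)) * deBruijnPhi u : ℂ)) (Ioi 0) := by
  have hc : Continuous fun u : ℝ =>
      cexp (z * u) * (Real.exp (-(c * u ^ 2)) * deBruijnPhi u : ℂ) := by
    have := continuous_deBruijnPhi
    fun_prop
  refine (integrableOn_deBruijnHBound (-c) |z.re|).mono' hc.aestronglyMeasurable.restrict
    (ae_restrict_of_forall_mem measurableSet_Ioi fun u (hu : 0 < u) => ?_)
  rw [deBruijnHBound, neg_mul, norm_mul, norm_mul, Complex.norm_real, Complex.norm_real,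
    Real.norm_eq_abs, Real.norm_eq_abs, abs_of_pos (Real.exp_pos _), Complex.norm_exp, mul_comm]
  gcongr
  rw [show (z * (u : ℂ)).re = z.re * u by simp]
  exact mul_le_mul_of_nonneg_right (le_abs_self _) hu.le

/-- The tilted Laplace integrand `e^{zu} e^{-cu²} Φ(u)` is integrable on `(−∞, 0]`, by reflection
`u ↦ −u` and the evenness of `Φ` (`Literature.NumberTheory.LFunctions.deBruijnPhi_neg_holds`) and
of `e^{-cu²}`. -/
theorem integrableOn_exp_mul_gauss_deBruijnPhi_Iic (c : ℝ) (z : ℂ) :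
    IntegrableOn
      (fun u : ℝ => cexp (z * u) * (Real.exp (-(c * u ^ 2)) * deBruijnPhi u : ℂ)) (Iic 0) := by
  rw [← Measure.map_neg_eq_self (volume : Measure ℝ)]
  let m : MeasurableEmbedding fun x : ℝ => -x := (Homeomorph.neg ℝ).measurableEmbedding
  rw [m.integrableOn_map_iff]
  simp_rw [Function.comp_def, neg_preimage, neg_Iic, neg_zero]
  have := integrableOn_exp_mul_gauss_deBruijnPhi_Ioi c (-z)
  refine Iff.mpr integrableOn_Ici_iff_integrableOn_Ioi
    (this.congr_fun (fun u _ => ?_) measurableSet_Ioi)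
  simp only [deBruijnPhi_neg_holds u, even_two.neg_pow]
  push_cast
  ring_nf

/-- The tilted Laplace integrand `e^{zu} e^{-cu²} Φ(u)` is integrable on `ℝ`. -/
theorem integrable_exp_mul_gauss_deBruijnPhi (c : ℝ) (z : ℂ) :
    Integrable (fun u : ℝ => cexp (z * u) * (Real.exp (-(c * u ^ 2)) * deBruijnPhi u : ℂ)) := by
  rw [← integrableOn_univ, ← Iic_union_Ioi (a := (0 : ℝ)), integrableOn_union]
  exact ⟨integrableOn_exp_mul_gauss_deBruijnPhi_Iic c z,
    integrableOn_exp_mul_gauss_deBruijnPhi_Ioi c z⟩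

/-- **Two-sided Laplace transform of the Gaussian tilt `e^{-cu²} Φ`**:
`∫_ℝ e^{zu} e^{-cu²} Φ(u) du = 2 ∫₀^∞ e^{-cu²} Φ(u) cosh(zu) du = 2 H_{-c}(iz)`, since `Φ` and
`e^{-cu²}` are even (the case `c = 0` is
`Literature.NumberTheory.LFunctions.integral_exp_mul_deBruijnPhi`, Titchmarsh §10.1). -/
theorem integral_exp_mul_gauss_deBruijnPhi (c : ℝ) (z : ℂ) :
    ∫ u : ℝ, cexp (z * u) * (Real.exp (-(c * u ^ 2)) * deBruijnPhi u : ℂ) =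
      2 * deBruijnH (-c) (I * z) := by
  set g : ℝ → ℂ := fun u => cexp (z * u) * (Real.exp (-(c * u ^ 2)) * deBruijnPhi u : ℂ) with hg
  have hIoi := integrableOn_exp_mul_gauss_deBruijnPhi_Ioi c z
  have hIoi' := integrableOn_exp_mul_gauss_deBruijnPhi_Ioi c (-z)
  have hIic := integrableOn_exp_mul_gauss_deBruijnPhi_Iic c z
  have h1 : ∫ u : ℝ, g u = (∫ u in Iic (0 : ℝ), g u) + ∫ u in Ioi (0 : ℝ), g u := by
    rw [← setIntegral_union (Iic_disjoint_Ioi le_rfl) measurableSet_Ioi hIic hIoi,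
      Iic_union_Ioi, Measure.restrict_univ]
  have h2 : ∫ u in Iic (0 : ℝ), g u =
      ∫ u in Ioi (0 : ℝ), cexp (-z * u) * (Real.exp (-(c * u ^ 2)) * deBruijnPhi u : ℂ) := by
    rw [← neg_zero, ← integral_comp_neg_Iic, neg_zero]
    refine setIntegral_congr_fun measurableSet_Iic fun u _ => ?_
    simp only [hg, deBruijnPhi_neg_holds u, even_two.neg_pow]
    push_cast
    ring_nf
  rw [h1, h2, ← integral_add hIoi' hIoi, deBruijnH_eq_integral, ← integral_const_mul]
  refine setIntegral_congr_fun measurableSet_Ioi fun u _ => ?_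
  simp only [deBruijnHIntegrand, neg_mul, show I * z * (u : ℂ) = z * u * I by ring,
    Complex.cos_mul_I, ← mul_assoc]
  linear_combination (-((Real.exp (-(c * u ^ 2)) : ℂ) * (deBruijnPhi u : ℂ))) *
    Complex.two_cosh (z * u)

end Laplace

/-- **Stub K0 — `ν_Φ` lies on the Lee–Yang boundary.** For the de Bruijn law `ν_Φ = Φ du/∫Φ` and
every `c > 0`, the anti-tilted measure `e^{-cu²} dν_Φ(u)` does not have the Lee–Yang property:
its two-sided Laplace transform is `z ↦ (∫Φ)⁻¹ · 2 H_{-c}(iz)` and `H_{-c}` has a non-real zero by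
Newman's conjecture (`Literature.NumberTheory.LFunctions.rodgers_tao_holds`, Rodgers–Tao 2020 /
Dobner 2021, a closed theorem of the tree). -/
theorem stub_boundary : ∀ ν : ProbabilityMeasure ℝ,
    (ν : Measure ℝ) = (∫⁻ u, ENNReal.ofReal (deBruijnPhi u))⁻¹ •
        volume.withDensity (fun u => ENNReal.ofReal (deBruijnPhi u)) →
    ∀ c : ℝ, 0 < c →
      ¬ HasLeeYangProperty
        ((ν : Measure ℝ).withDensity fun u => ENNReal.ofReal (Real.exp (-(c * u ^ 2)))) := by
  intro ν hν c hc hLY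
  -- Newman's conjecture (Rodgers–Tao; Dobner): `H_{-c}` has a zero `w` off the real axis
  have hRT := rodgers_tao_holds (-c) (neg_lt_zero.2 hc)
  simp only [HasOnlyRealZeros, not_forall, exists_prop] at hRT
  obtain ⟨w, hw, hwim⟩ := hRT
  -- measurability of the two densities
  have hmeasΦ : Measurable fun u : ℝ => ENNReal.ofReal (deBruijnPhi u) :=
    continuous_deBruijnPhi.measurable.ennreal_ofReal
  have hmeasG : Measurable fun u : ℝ => ENNReal.ofReal (Real.exp (-(c * u ^ 2))) :=
    (by fun_prop : Continuous fun u : ℝ => Real.exp (-(c * u ^ 2))).measurable.ennreal_ofReal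
  -- `2 H_{-c}(I · (-I w)) = 2 H_{-c}(w) = 0`
  have h0 : (2 : ℂ) * deBruijnH (-c) (Complex.I * (-Complex.I * w)) = 0 := by
    rw [← mul_assoc, mul_neg, Complex.I_mul_I, neg_neg, one_mul, hw, mul_zero]
  -- the Laplace transform of the tilted law is `(∫Φ)⁻¹ ∫ e^{zu} e^{-cu²} Φ(u) du`, which at
  -- `z = -I w` equals `(∫Φ)⁻¹ · 2 H_{-c}(w) = 0`
  have hz : (∫ u, Complex.exp (-Complex.I * w * u)
      ∂((ν : Measure ℝ).withDensity fun u => ENNReal.ofReal (Real.exp (-(c * u ^ 2))))) = 0 := by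
    rw [integral_withDensity_eq_integral_toReal_smul hmeasG
        (Filter.Eventually.of_forall fun _ => ENNReal.ofReal_lt_top), hν, integral_smul_measure,
      integral_withDensity_eq_integral_toReal_smul hmeasΦ
        (Filter.Eventually.of_forall fun _ => ENNReal.ofReal_lt_top), smul_eq_zero]
    refine Or.inr ((integral_congr_ae (Filter.Eventually.of_forall fun u => ?_)).trans
      ((integral_exp_mul_gauss_deBruijnPhi c (-Complex.I * w)).trans h0))
    simp only [ENNReal.toReal_ofReal (deBruijnPhi_pos_holds u).le,
      ENNReal.toReal_ofReal (Real.exp_pos _).le, Complex.real_smul]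
    ring
  -- the Lee–Yang property would force `re (-I w) = im w = 0`
  have key := hLY (-Complex.I * w) hz
  apply hwim
  simpa using key

end Summit.RiemannHypothesis.RiemannHypothesis.Theorems.LeeYangProductTowers

end
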